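import Mathlib.MeasureTheory.Function.JacobianOneDim
import Mathlib.Analysis.SpecialFunctions.Complex.Arg
import Mathlib.Analysis.SpecialFunctions.Trigonometric.Complex
import Mathlib.Analysis.SpecialFunctions.Trigonometric.Deriv
import Mathlib.Algebra.Polynomial.Roots
import Literature.MathematicalPhysics.QuantumLattice.KohnLuttingerLindhardMeasurable
import HarnessLib

/-!
# The interpolated band `W(s, y) = -2((1-s) cos y + s cos(y + q)) + s d` of the Lindhard slice:
# amplitude, phase, level points, the slice parameter `S(y)` and its derivative

Cell `gate-hubbard-kl`, item stmt-HubbardSuperconductivity-19294 `LindhardPointwiseIdentification`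
(CERT-SREP §1 Prop. 1–2: `χ₀(q; μ) = ∫₀¹ ρ(μ; A₀(s), A₁(s)) ds`, the Feynman/"s"-parametrised form of
the Lindhard function of Raghu–Kivelson–Scalapino eq. (5)). After Fubini in `p = (x, y)` the
identity at a FIXED first coordinate `x` concerns, with `t = μ + 2 cos x`,
`d = 2 cos x - 2 cos(x + q₀)`, `q = q₁`: the bare slice `w₀(y) = -2 cos y`, the energy difference
`D(y) = d + 2 cos y - 2 cos(y + q)` (`= ε(p+q) - ε(p)`), the interpolated band
`W(s, y) = w₀(y) + s D(y) = -2((1-s) cos y + s cos(y+q)) + s d` and the slice parameter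
`S(y) = (t - w₀(y))/D(y)` — the unique `s` with `W(s, y) = t`. This file proves the pointwise
facts used by the change of variables `s = S(y)` of `LindhardSliceKeyLemma.lean`:

* `aniso_amplitude_sq` — `(W(s,y) - sd)² + (∂_y W(s,y))² = 4A(s)²`, `A(s)² = 1 - 4s(1-s) sin²(q/2)`;
* `aniso_phase_exists` — `(1-s) + s e^{iq} = A e^{iφ}`, so `W(s,y) = -2A cos(y+φ) + sd`;
* `aniso_level_injOn` / `aniso_level_exists` — on `[-π,π)`, a level `W(s,·) = t` is met at most
  once with `σ ∂_y W > 0` (`σ = ±1`), and at least once if `(t - sd)² < 4A(s)²`;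
* `aniso_W_sliceS`, `aniso_sliceS_eq_of_W_eq` — `W(S(y), y) = t` and uniqueness (`D(y) ≠ 0`);
* `hasDerivAt_sliceS` — `S' = -∂_y W(S(y), y)/D(y)`; `aniso_R_sliceS_eq_sq` —
  `4A(S y)² - (t - S(y)d)² = (∂_y W(S y, y))²`; `aniso_slice_integrand` — hence
  `|S'(y)| / √(4A(S y)² - (t - S(y) d)²) = 1/|D(y)|`, the Jacobian identity of the key lemma.

Theorems only, no definitions (all objects are explicit expressions in `t, d, q, y, s`).

## References
* S. Raghu, S. A. Kivelson, D. J. Scalapino, Phys. Rev. B 81 (2010) 224505, §II eq. (5) (the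
  Lindhard function) [RaghuKivelsonScalapino2010].
-/

noncomputable section

open Real Set MeasureTheory MeasureTheory.Measure
open scoped Topology ENNReal

namespace Literature.MathematicalPhysics.QuantumLattice

/-! ### The interpolated band `W(s, ·)`: amplitude and phase -/

/-- `sin²(q/2) = (1 - cos q)/2`. [cite: RaghuKivelsonScalapino2010, §II (5)] -/
theorem sin_sq_half_eq (q : ℝ) : Real.sin (q / 2) ^ 2 = 1 / 2 - Real.cos q / 2 := by
  rw [Real.sin_sq, Real.cos_sq (q / 2), show 2 * (q / 2) = q by ring]
  ring

/-- **Amplitude identity of the interpolated band**: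
`((1-s) cos y + s cos(y+q))² + ((1-s) sin y + s sin(y+q))² = 1 - 4 s (1-s) sin²(q/2)` (`= A(s)²`),
i.e. `(W(s,y) - sd)² + (∂_y W(s,y))² = 4A(s)²` for `W(s,y) = -2((1-s) cos y + s cos(y+q)) + sd`.
[cite: RaghuKivelsonScalapino2010, §II (5)] -/
theorem aniso_amplitude_sq (s q y : ℝ) :
    ((1 - s) * Real.cos y + s * Real.cos (y + q)) ^ 2 + ((1 - s) * Real.sin y + s * Real.sin (y + q)) ^ 2 =
      1 - 4 * s * (1 - s) * Real.sin (q / 2) ^ 2 := by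
  rw [sin_sq_half_eq, Real.cos_add, Real.sin_add]
  have h1 := Real.sin_sq_add_cos_sq y
  have h2 := Real.sin_sq_add_cos_sq q
  linear_combination ((1 - s) ^ 2 + 2 * s * (1 - s) * Real.cos q + s ^ 2 * (Real.sin q ^ 2 + Real.cos q ^ 2)) * h1 +
    s ^ 2 * h2

/-- **Phase form of the interpolated band**: for every `s, q` there are `A ≥ 0` with
`A² = 1 - 4s(1-s) sin²(q/2)` and a phase `φ` with `(1-s) cos y + s cos(y+q) = A cos(y + φ)` and
`(1-s) sin y + s sin(y+q) = A sin(y + φ)` for all `y` (`A e^{iφ} = (1-s) + s e^{iq}`).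
[cite: RaghuKivelsonScalapino2010, §II (5)] -/
theorem aniso_phase_exists (s q : ℝ) :
    ∃ A φ : ℝ, 0 ≤ A ∧ A ^ 2 = 1 - 4 * s * (1 - s) * Real.sin (q / 2) ^ 2 ∧
      ∀ y : ℝ, (1 - s) * Real.cos y + s * Real.cos (y + q) = A * Real.cos (y + φ) ∧
        (1 - s) * Real.sin y + s * Real.sin (y + q) = A * Real.sin (y + φ) := by
  set P : ℝ := (1 - s) + s * Real.cos q with hP
  set Q : ℝ := s * Real.sin q with hQ
  set z : ℂ := ⟨P, Q⟩ with hz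
  refine ⟨‖z‖, Complex.arg z, norm_nonneg _, ?_, fun y => ⟨?_, ?_⟩⟩
  · have h := aniso_amplitude_sq s q 0
    simp only [Real.cos_zero, Real.sin_zero, zero_add, mul_one, mul_zero] at h
    rw [← h, Complex.sq_norm, Complex.normSq_mk]
    ring
  · have hc : ‖z‖ * Real.cos (Complex.arg z) = P := Complex.norm_mul_cos_arg z
    have hs : ‖z‖ * Real.sin (Complex.arg z) = Q := Complex.norm_mul_sin_arg z
    calc (1 - s) * Real.cos y + s * Real.cos (y + q) = P * Real.cos y - Q * Real.sin y := by
          rw [hP, hQ, Real.cos_add]; ring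
      _ = ‖z‖ * Real.cos (y + Complex.arg z) := by rw [← hc, ← hs, Real.cos_add]; ring
  · have hc : ‖z‖ * Real.cos (Complex.arg z) = P := Complex.norm_mul_cos_arg z
    have hs : ‖z‖ * Real.sin (Complex.arg z) = Q := Complex.norm_mul_sin_arg z
    calc (1 - s) * Real.sin y + s * Real.sin (y + q) = P * Real.sin y + Q * Real.cos y := by
          rw [hP, hQ, Real.sin_add]; ring
      _ = ‖z‖ * Real.sin (y + Complex.arg z) := by rw [← hc, ← hs, Real.sin_add]; ring

/-- **Injectivity on a monotone piece**: two points of `[-π, π)` on the same level of `W(s,·)` at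
which `∂_y W(s,·)` has the same (strict) sign coincide (`cos` is injective on `(0, π)` after the
phase shift). [cite: RaghuKivelsonScalapino2010, §II (5)] -/
theorem aniso_level_injOn (s q d σ : ℝ) {y₁ y₂ : ℝ}
    (hy₁ : y₁ ∈ Ico (-π) π) (hy₂ : y₂ ∈ Ico (-π) π)
    (hW : -2 * ((1 - s) * Real.cos y₁ + s * Real.cos (y₁ + q)) + s * d =
      -2 * ((1 - s) * Real.cos y₂ + s * Real.cos (y₂ + q)) + s * d)
    (h₁ : 0 < σ * (2 * ((1 - s) * Real.sin y₁ + s * Real.sin (y₁ + q))))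
    (h₂ : 0 < σ * (2 * ((1 - s) * Real.sin y₂ + s * Real.sin (y₂ + q)))) : y₁ = y₂ := by
  obtain ⟨A, φ, hA0, -, hφ⟩ := aniso_phase_exists s q
  have hc : A * Real.cos (y₁ + φ) = A * Real.cos (y₂ + φ) := by
    rw [← (hφ y₁).1, ← (hφ y₂).1]; linarith
  rw [(hφ y₁).2] at h₁
  rw [(hφ y₂).2] at h₂
  have hApos : 0 < A := by
    rcases hA0.lt_or_eq with h | h
    · exact h
    · rw [← h] at h₁; simp at h₁
  have hcos : Real.cos (y₁ + φ) = Real.cos (y₂ + φ) := mul_left_cancel₀ hApos.ne' hc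
  have hs₁ : 0 < σ * Real.sin (y₁ + φ) := by nlinarith
  have hs₂ : 0 < σ * Real.sin (y₂ + φ) := by nlinarith
  obtain ⟨k, hk | hk⟩ := Real.cos_eq_cos_iff.1 hcos
  · -- `y₂ + φ = 2kπ + (y₁ + φ)` with both in a window of length `2π` forces `k = 0`
    have hy : y₂ - y₁ = 2 * k * π := by linarith
    have hk1 : |(k : ℝ)| < 1 := by
      have habs : |y₂ - y₁| < 2 * π := by
        rw [abs_lt]; constructor <;> linarith [hy₁.1, hy₁.2, hy₂.1, hy₂.2]
      rw [hy, abs_mul, abs_mul, abs_of_pos Real.pi_pos, abs_two] at habs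
      nlinarith [Real.pi_pos]
    have hk0 : k = 0 := by
      have : |k| < 1 := by exact_mod_cast hk1
      exact Int.abs_lt_one_iff.1 this
    rw [hk0] at hy; simp at hy; linarith
  · -- `y₂ + φ = 2kπ - (y₁ + φ)`: the sines have opposite signs
    have hsin : Real.sin (y₂ + φ) = -Real.sin (y₁ + φ) := by
      rw [hk, show (2 * (k : ℝ) * π - (y₁ + φ)) = (k : ℝ) * (2 * π) - (y₁ + φ) by ring,
        Real.sin_int_mul_two_pi_sub]
    rw [hsin] at hs₂
    nlinarith

/-- **Existence of a level point on a prescribed monotone piece**: if `(t - sd)² < 4A(s)²` then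
`W(s,·) = -2((1-s) cos · + s cos(· + q)) + sd` takes the value `t` at some `y ∈ [-π, π)` with
`σ ∂_y W(s, y) > 0`, for either sign `σ = ±1`. [cite: RaghuKivelsonScalapino2010, §II (5)] -/
theorem aniso_level_exists (s q d t σ : ℝ) (hσ : σ = 1 ∨ σ = -1)
    (hR : (t - s * d) ^ 2 < 4 * (1 - 4 * s * (1 - s) * Real.sin (q / 2) ^ 2)) :
    ∃ y ∈ Ico (-π) π, -2 * ((1 - s) * Real.cos y + s * Real.cos (y + q)) + s * d = t ∧
      0 < σ * (2 * ((1 - s) * Real.sin y + s * Real.sin (y + q))) := by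
  obtain ⟨A, φ, hA0, hA2, hφ⟩ := aniso_phase_exists s q
  have hApos : 0 < A := by
    rcases hA0.lt_or_eq with h | h
    · exact h
    · rw [← h] at hA2; nlinarith [sq_nonneg (t - s * d)]
  set c : ℝ := (s * d - t) / (2 * A) with hc
  have hc2 : c ^ 2 < 1 := by
    rw [hc, div_pow, div_lt_one (by positivity)]
    nlinarith
  have hc1 : -1 < c ∧ c < 1 := by
    have := abs_lt.1 ((sq_lt_one_iff_abs_lt_one c).1 hc2)
    exact this
  have hσ2 : σ * σ = 1 := by rcases hσ with rfl | rfl <;> norm_num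
  set θ : ℝ := σ * Real.arccos c with hθ
  have hcosθ : Real.cos θ = c := by
    rcases hσ with rfl | rfl
    · rw [hθ, one_mul, Real.cos_arccos hc1.1.le hc1.2.le]
    · rw [hθ, neg_one_mul, Real.cos_neg, Real.cos_arccos hc1.1.le hc1.2.le]
  have hsinθ : 0 < σ * Real.sin θ := by
    have hpos : 0 < Real.sin (Real.arccos c) := by
      rw [Real.sin_arccos]; exact Real.sqrt_pos.2 (by nlinarith)
    rcases hσ with rfl | rfl
    · rwa [hθ, one_mul, one_mul]
    · rw [hθ, neg_one_mul, neg_one_mul, Real.sin_neg, neg_neg]; exact hpos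
  set y : ℝ := toIcoMod Real.two_pi_pos (-π) (θ - φ) with hy
  have hmem : y ∈ Ico (-π) π := by
    have := toIcoMod_mem_Ico Real.two_pi_pos (-π) (θ - φ)
    rwa [show -π + 2 * π = π by ring] at this
  -- `y + φ = θ - n (2π)`
  have hyφ : y + φ = θ - (toIcoDiv Real.two_pi_pos (-π) (θ - φ) : ℝ) * (2 * π) := by
    have := self_sub_toIcoMod Real.two_pi_pos (-π) (θ - φ)
    rw [zsmul_eq_mul] at this
    rw [hy]; linarith
  have hcos : Real.cos (y + φ) = c := by rw [hyφ, Real.cos_sub_int_mul_two_pi, hcosθ]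
  have hsin : Real.sin (y + φ) = Real.sin θ := by rw [hyφ, Real.sin_sub_int_mul_two_pi]
  refine ⟨y, hmem, ?_, ?_⟩
  · rw [(hφ y).1, hcos, hc]
    field_simp
    ring
  · rw [(hφ y).2, hsin]
    have : σ * (2 * (A * Real.sin θ)) = 2 * A * (σ * Real.sin θ) := by ring
    rw [this]
    positivity

/-- At a point with `D(y) ≠ 0` the parameter `S(y) = (t - w₀(y))/D(y)` is the unique `s` with
`W(s, y) = t`: `W(S(y), y) = t`. [cite: RaghuKivelsonScalapino2010, §II (5)] -/
theorem aniso_W_sliceS (t d q y : ℝ) (hD : d + (2 * Real.cos y - 2 * Real.cos (y + q)) ≠ 0) :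
    -2 * ((1 - (t + 2 * Real.cos y) / (d + (2 * Real.cos y - 2 * Real.cos (y + q)))) * Real.cos y +
        (t + 2 * Real.cos y) / (d + (2 * Real.cos y - 2 * Real.cos (y + q))) * Real.cos (y + q)) +
      (t + 2 * Real.cos y) / (d + (2 * Real.cos y - 2 * Real.cos (y + q))) * d = t := by
  set D : ℝ := d + (2 * Real.cos y - 2 * Real.cos (y + q)) with hDdef
  set s : ℝ := (t + 2 * Real.cos y) / D with hs
  have hsD : s * D = t + 2 * Real.cos y := div_mul_cancel₀ _ hD
  have hcq : Real.cos (y + q) = Real.cos y + (d - D) / 2 := by rw [hDdef]; ring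
  rw [hcq]
  linear_combination hsD

/-- If `W(s, y) = t` and `D(y) ≠ 0` then `s = S(y)` (`W` is affine in `s` with slope `D(y)`).
[cite: RaghuKivelsonScalapino2010, §II (5)] -/
theorem aniso_sliceS_eq_of_W_eq (s t d q y : ℝ) (hD : d + (2 * Real.cos y - 2 * Real.cos (y + q)) ≠ 0)
    (hW : -2 * ((1 - s) * Real.cos y + s * Real.cos (y + q)) + s * d = t) :
    (t + 2 * Real.cos y) / (d + (2 * Real.cos y - 2 * Real.cos (y + q))) = s := by
  rw [div_eq_iff hD, ← hW]
  ring

/-- **Derivative of the slice parameter**: where `D(y) ≠ 0`,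
`S'(y) = -∂_y W(S(y), y) / D(y)` with `∂_y W(s, y) = 2((1-s) sin y + s sin(y+q))`.
[cite: RaghuKivelsonScalapino2010, §II (5)] -/
theorem hasDerivAt_sliceS (t d q y : ℝ) (hD : d + (2 * Real.cos y - 2 * Real.cos (y + q)) ≠ 0) :
    HasDerivAt (fun y : ℝ => (t + 2 * Real.cos y) / (d + (2 * Real.cos y - 2 * Real.cos (y + q))))
      (-(2 * ((1 - (t + 2 * Real.cos y) / (d + (2 * Real.cos y - 2 * Real.cos (y + q)))) * Real.sin y +
        (t + 2 * Real.cos y) / (d + (2 * Real.cos y - 2 * Real.cos (y + q))) * Real.sin (y + q))) /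
        (d + (2 * Real.cos y - 2 * Real.cos (y + q)))) y := by
  have hnum : HasDerivAt (fun y : ℝ => t + 2 * Real.cos y) (2 * -Real.sin y) y :=
    ((Real.hasDerivAt_cos y).const_mul 2).const_add t
  have hden : HasDerivAt (fun y : ℝ => d + (2 * Real.cos y - 2 * Real.cos (y + q)))
      (2 * -Real.sin y - 2 * -Real.sin (y + q)) y := by
    have h1 := (Real.hasDerivAt_cos y).const_mul 2
    have h2 : HasDerivAt (fun y : ℝ => 2 * Real.cos (y + q)) (2 * -Real.sin (y + q)) y := by
      have := ((Real.hasDerivAt_cos (y + q)).comp y ((hasDerivAt_id y).add_const q)).const_mul 2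
      simpa using this
    exact (h1.sub h2).const_add d
  set D : ℝ := d + (2 * Real.cos y - 2 * Real.cos (y + q)) with hDdef
  refine (hnum.div hden hD).congr_deriv ?_
  rw [← hDdef]
  field_simp
  ring

/-- On the slice `s = S(y)` (`D(y) ≠ 0`): `4A(S y)² - (t - S(y) d)² = (∂_y W(S y, y))²` (the amplitude
identity at a point of the level curve `W = t`). [cite: RaghuKivelsonScalapino2010, §II (5)] -/
theorem aniso_R_sliceS_eq_sq (t d q y : ℝ) (hD : d + (2 * Real.cos y - 2 * Real.cos (y + q)) ≠ 0) :
    4 * (1 - 4 * ((t + 2 * Real.cos y) / (d + (2 * Real.cos y - 2 * Real.cos (y + q)))) *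
        (1 - (t + 2 * Real.cos y) / (d + (2 * Real.cos y - 2 * Real.cos (y + q)))) * Real.sin (q / 2) ^ 2) -
        (t - (t + 2 * Real.cos y) / (d + (2 * Real.cos y - 2 * Real.cos (y + q))) * d) ^ 2 =
      (2 * ((1 - (t + 2 * Real.cos y) / (d + (2 * Real.cos y - 2 * Real.cos (y + q)))) * Real.sin y +
        (t + 2 * Real.cos y) / (d + (2 * Real.cos y - 2 * Real.cos (y + q))) * Real.sin (y + q))) ^ 2 := by
  set D : ℝ := d + (2 * Real.cos y - 2 * Real.cos (y + q)) with hDdef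
  set s : ℝ := (t + 2 * Real.cos y) / D with hs
  have hWt : -2 * ((1 - s) * Real.cos y + s * Real.cos (y + q)) + s * d = t := aniso_W_sliceS t d q y hD
  have h := aniso_amplitude_sq s q y
  have h1 : (t - s * d) ^ 2 = 4 * ((1 - s) * Real.cos y + s * Real.cos (y + q)) ^ 2 := by
    rw [← hWt]; ring
  rw [h1]; nlinarith [h]

/-- **The integrand identity on a monotone piece**: if `D(y) ≠ 0` and `∂_y W(S(y), y) ≠ 0` then
`|S'(y)| · (4A(S y)² - (t - S(y) d)²)^{-1/2} = 1/|D(y)|`, because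
`4A(s)² - (t - sd)² = (∂_y W(s,y))²` at `W(s,y) = t`. [cite: RaghuKivelsonScalapino2010, §II (5)] -/
theorem aniso_slice_integrand (t d q y : ℝ) (hD : d + (2 * Real.cos y - 2 * Real.cos (y + q)) ≠ 0)
    (hW' : 2 * ((1 - (t + 2 * Real.cos y) / (d + (2 * Real.cos y - 2 * Real.cos (y + q)))) * Real.sin y +
        (t + 2 * Real.cos y) / (d + (2 * Real.cos y - 2 * Real.cos (y + q))) * Real.sin (y + q)) ≠ 0) :
    ENNReal.ofReal |(-(2 * ((1 - (t + 2 * Real.cos y) / (d + (2 * Real.cos y - 2 * Real.cos (y + q)))) * Real.sin y +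
        (t + 2 * Real.cos y) / (d + (2 * Real.cos y - 2 * Real.cos (y + q))) * Real.sin (y + q))) /
        (d + (2 * Real.cos y - 2 * Real.cos (y + q))))| *
      ENNReal.ofReal (1 / Real.sqrt (4 * (1 - 4 * ((t + 2 * Real.cos y) / (d + (2 * Real.cos y - 2 * Real.cos (y + q)))) *
        (1 - (t + 2 * Real.cos y) / (d + (2 * Real.cos y - 2 * Real.cos (y + q)))) * Real.sin (q / 2) ^ 2) -
        (t - (t + 2 * Real.cos y) / (d + (2 * Real.cos y - 2 * Real.cos (y + q))) * d) ^ 2)) =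
      ENNReal.ofReal (1 / |d + (2 * Real.cos y - 2 * Real.cos (y + q))|) := by
  set D : ℝ := d + (2 * Real.cos y - 2 * Real.cos (y + q)) with hDdef
  set s : ℝ := (t + 2 * Real.cos y) / D with hs
  set W' : ℝ := 2 * ((1 - s) * Real.sin y + s * Real.sin (y + q)) with hW'def
  have hR : 4 * (1 - 4 * s * (1 - s) * Real.sin (q / 2) ^ 2) - (t - s * d) ^ 2 = W' ^ 2 :=
    aniso_R_sliceS_eq_sq t d q y hD
  rw [hR, Real.sqrt_sq_eq_abs, ← ENNReal.ofReal_mul (abs_nonneg _)]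
  congr 1
  rw [abs_div, abs_neg]
  have hW'0 : |W'| ≠ 0 := abs_ne_zero.2 hW'
  have hD0 : |D| ≠ 0 := abs_ne_zero.2 hD
  field_simp

end Literature.MathematicalPhysics.QuantumLattice

end
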